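import Summits.QuantumAdvantage.AdviceFreeQNC0.AffBells35WRELTypical

/-!
# qa-qnc0-p1 g35 — `PolyLossOfWREL` and the wired-elimination line, part 5/7: fibrewise structure of perfect fibres; the private-coin lemma; window flips

Continuation of `AffBells35WRELTypical`.

Ported to the tree VERBATIM (split into seven files `AffBells35PolyLossOfWREL` / `AffBells35WREL{Firing,Quiet,Typical,Structure,Twins,Toggle}` for the 400-line rule; lint fixes only: `push Not`, `card_filter_add_card_filter_not`, unused simp arguments, two `_`-binders) by the prover seat qn-prover-3 g20 at the ask of planner qa-qnc0-p1 g36 (INBOX 11:15Z: exp35/WREL35.lean FROZEN, 1891 l., farm rc 0 / 0 sorry); authored and proved by the planner seat qa-qnc0-p1 g35.  Serves the crux stmt-QuantumAdvantage-22907 (route DWalkThree); untagged (the gate refuses `--supports` across sub-problems on AdviceFreeQNC0/ targets).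
-/

noncomputable section
open Classical

namespace Summit.QuantumAdvantage.AdviceFreeQNC0.AffBells35

open Finset Literature.Computability.QuantumComplexity Literature.Computability.QuantumComplexity.RingHLF
open AffBells23 Fib19 AffBells26 AffBells29

variable {N : ℕ}

/-! ### FIBREWISE STRUCTURE of perfect fibres (deterministic consequences of `quiet_of_coinSeparated`, ROUND-34 §12.12(v)) -/

section Structure

open Literature.Computability.MetaComplexity Literature.Computability.MetaComplexity.HoloCoset
open Literature.Computability.MetaComplexity.CosetFourier Literature.Computability.MetaComplexity.ParityModTestDensity

/-- bookkeeping: `win ⟺ #quiet active bells ≡ pairs2 (J)` (from `targetFormula` and `|act| + zeros = N`). -/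
theorem rel_iff_quietCount_univ (hN : 3 ≤ N) (β : Fin N → Fin N → ZMod 3) (c : Fin N → ZMod 3)
    (x : Fin N → Bool) (hodd : IsOdd x) :
    RingHLF.Rel x (affBell β c x) ↔ (quietCount β c univ x + pairs2 (kline x)) % 2 = 0 := by
  rw [targetFormula N hN x hodd]
  have h1 : (univ.filter fun g : Fin N => kline x g = true).card + zeros (kline x) = N := by
    unfold zeros
    have hneg : (univ.filter fun g : Fin N => ¬ kline x g = true) = univ.filter fun i : Fin N => kline x i = false := by
      simp only [Bool.not_eq_true]
    rw [← hneg, card_filter_add_card_filter_not, card_univ, Fintype.card_fin]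
  have hs := card_filter_add_card_filter_not (s := univ.filter fun g : Fin N => kline x g = true)
    (fun b => affBell β c x b = true)
  have e1 : ((univ.filter fun g : Fin N => kline x g = true).filter fun b => affBell β c x b = true).card
      = activeOnes x (affBell β c x) := by
    unfold activeOnes
    rw [filter_filter]
  have e2 : ((univ.filter fun g : Fin N => kline x g = true).filter fun b => ¬ affBell β c x b = true).card
      = quietCount β c univ x := by
    unfold quietCount
    rw [filter_filter]
    congr 1
    ext b
    simp
  rw [e1, e2] at hs
  omega

/-- **STRUCTURE (1).**  A perfect fibre all of whose ACTIVE rows have `≥ dScale N` coins has `pairs2 (J)` even.  (So a strategy whose rows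
are all `≥ C₂ log N` wide wins only `½ + o(1)` — `AffBells29lit.abs_card_pairs2_even_sub_le` — and every near-perfect strategy needs, on
almost every fibre with `pairs2` odd, an active row with `< dScale N` coins.) -/
theorem pairs2_even_of_perfect_wide (hDSZ : DualSZDecoupling) (hN : 3 ≤ N)
    (β : Fin N → Fin N → ZMod 3) (c : Fin N → ZMod 3) (x : Fin N → Bool) (hodd : IsOdd x)
    (HW : ∀ h, kline x h = true → dScale N ≤ coinDist β x (β h) (fun _ => 0))
    (hperf : PerfectFibre β c (kline x)) : pairs2 (kline x) % 2 = 0 := by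
  have hq := quiet_of_coinSeparated hDSZ hN β c univ x hodd (fun h _ hact => HW h hact)
    (fun h h' _ _ hK' _ => absurd (mem_univ h') hK') hperf x hodd rfl
  have hrel := (rel_iff_quietCount_univ hN β c x hodd).1 (hperf x hodd rfl)
  omega

/-- **STRUCTURE (2) — the light class carries the parity.**  If the active rows OUTSIDE `K` are `dScale`-coin-wide and `dScale`-coin-
separated from the active rows of `K`, then on a perfect fibre `#quiet K-bells ≡ pairs2 (J)` at every input of the fibre.  (With (1):
on a perfect fibre the active terms split into coin-components; every coin-wide one is silent, all coin-light rows sit in ONE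
component `L(J)`, and `quietCount L(J) ≡ pairs2 (J)`; firing `L(J)`'s rows to always-true is harmless iff `pairs2 (J)` is even,
to one always-false + rest always-true iff … — the constant-selection problem of §12.12(v).) -/
theorem quiet_parity_of_cowide (hDSZ : DualSZDecoupling) (hN : 3 ≤ N)
    (β : Fin N → Fin N → ZMod 3) (c : Fin N → ZMod 3) (K : Finset (Fin N)) (x : Fin N → Bool) (hodd : IsOdd x)
    (HW : ∀ h, h ∉ K → kline x h = true → dScale N ≤ coinDist β x (β h) (fun _ => 0))
    (HS : ∀ h h', h ∉ K → kline x h = true → h' ∈ K → kline x h' = true →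
      dScale N ≤ coinDist β x (β h) (β h') ∧ dScale N ≤ coinDist β x (β h) (fun i => 2 * β h' i))
    (hperf : PerfectFibre β c (kline x)) :
    ∀ x', IsOdd x' → kline x' = kline x → quietCount β c K x' % 2 = pairs2 (kline x) % 2 := by
  intro x' hodd' hk
  have hq := quiet_of_coinSeparated hDSZ hN β c Kᶜ x hodd (fun h hK hact => HW h (mem_compl.1 hK) hact)
    (fun h h' hK hact hK' hact' => HS h h' (mem_compl.1 hK) hact (by simpa using hK') hact') hperf x' hodd' hk
  have hrel := (rel_iff_quietCount_univ hN β c x' hodd').1 (hperf x' hodd' hk)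
  have hsplit : quietCount β c K x' + quietCount β c Kᶜ x' = quietCount β c univ x' := by
    unfold quietCount
    rw [← card_union_of_disjoint (disjoint_filter.2 fun h _ h1 h2 => (mem_compl.1 h2.1) h1.1)]
    congr 1
    ext h
    simp only [mem_union, mem_filter, mem_univ, true_and, mem_compl]
    tauto
  rw [hk] at hrel
  omega

end Structure


/-! ### Typed next target (P-38aq, ROUND-34 §12.12(v)(6)(α)): the PRIVATE-COIN LEMMA — first formal instance of intra-chain transparency. -/

/-- **P-38aq `PrivateCoinLemma` (M; the singleton lemma of the wire programme in its cleanest form).**  On a perfect fibre no ACTIVE row `h₁`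
can own a PRIVATE coin `i₀` (a coin in its support read by no other active row) while reading a second coin `i₂`, provided a FREE coin
`i₁` (read by no active row) exists.  Proof (§12.12(v)(6)): with `B = ω^{-r}χ_v` the off-window part of `h₁`'s term, flipping `u_{i₀}`
(parity repaired at `i₁`) gives `B² = ωB`, so `B ≡ ω`, so `χ_v` is constant; flipping `u_{i₂}` contradicts `v_{i₂} ≠ 0`.  For the bare
staircase the top active row owns the coins above the next active row — this re-proves its constant loss (K-90) and is the `k = 1`
case of the transparency lemma P-38ao. -/
def PrivateCoinLemma : Prop :=
  ∀ N ≥ 3, ∀ (β : Fin N → Fin N → ZMod 3) (c : Fin N → ZMod 3) (x : Fin N → Bool) (h₁ i₀ i₁ i₂ : Fin N),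
    IsOdd x → kline x h₁ = true → i₀ ≠ i₁ → i₀ ≠ i₂ → i₁ ≠ i₂ →
    kline x i₀ = false → kline x i₁ = false → kline x i₂ = false →
    β h₁ i₀ ≠ 0 → β h₁ i₁ = 0 → β h₁ i₂ ≠ 0 →
    (∀ g, kline x g = true → g ≠ h₁ → β g i₀ = 0) →
    (∀ g, kline x g = true → β g i₁ = 0) →
    ¬ PerfectFibre β c (kline x)


section PrivateCoin

open AffBells33 AffBells28 AffBells28lit

/-- indicator of the pair `{a, b}` of coin indices. -/
def pairY {Z : ℕ} (a b : Fin Z) : Fin Z → Bool := fun t => decide (t = a ∨ t = b)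

/-- `onesCard_pairY` (planner qa-qnc0-p1 g35, exp35/WREL35.lean; see the section header above). -/
theorem onesCard_pairY {Z : ℕ} {a b : Fin Z} (hab : a ≠ b) : AffBells33.onesCard (pairY a b) % 2 = 0 := by
  unfold AffBells33.onesCard pairY
  have : (univ.filter fun i : Fin Z => decide (i = a ∨ i = b) = true) = {a, b} := by
    ext i; simp
  rw [this, card_pair hab]

/-- `onesCard_zeroY` (planner qa-qnc0-p1 g35, exp35/WREL35.lean; see the section header above). -/
theorem onesCard_zeroY {Z : ℕ} : AffBells33.onesCard (fun _ : Fin Z => false) % 2 = 0 := by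
  unfold AffBells33.onesCard; simp

/-- `sum_pairY` (planner qa-qnc0-p1 g35, exp35/WREL35.lean; see the section header above). -/
theorem sum_pairY {Z : ℕ} {a b : Fin Z} (hab : a ≠ b) (f : Fin Z → ZMod 3) :
    (∑ t, if pairY a b t then f t else 0) = f a + f b := by
  have key : ∀ t, (if pairY a b t then f t else 0) = (if t = a then f t else 0) + (if t = b then f t else 0) := by
    intro t
    unfold pairY
    by_cases h1 : t = a
    · by_cases h2 : t = b
      · exact absurd (h1.symm.trans h2) hab
      · simp [h1, hab]
    · by_cases h2 : t = b
      · subst h2; simp [h1]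
      · simp [h1, h2]
  simp_rw [key]
  rw [sum_add_distrib, sum_ite_eq', sum_ite_eq']
  simp

/-- `mem_iff_of_card_mod_two` (planner qa-qnc0-p1 g35, exp35/WREL35.lean; see the section header above). -/
theorem mem_iff_of_card_mod_two {α : Type*} [DecidableEq α] (A A' : Finset α) (a : α)
    (h : ∀ b, b ≠ a → (b ∈ A ↔ b ∈ A')) (hc : A.card % 2 = A'.card % 2) : (a ∈ A ↔ a ∈ A') := by
  have he : A.erase a = A'.erase a := by
    ext b
    simp only [mem_erase]
    constructor
    · rintro ⟨hb, hm⟩; exact ⟨hb, (h b hb).1 hm⟩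
    · rintro ⟨hb, hm⟩; exact ⟨hb, (h b hb).2 hm⟩
  by_cases ha : a ∈ A <;> by_cases ha' : a ∈ A'
  · exact ⟨fun _ => ha', fun _ => ha⟩
  · exfalso
    have h1 := card_erase_add_one ha
    rw [he, erase_eq_of_notMem ha'] at h1
    omega
  · exfalso
    have h1 := card_erase_add_one ha'
    rw [← he, erase_eq_of_notMem ha] at h1
    omega
  · exact ⟨fun h => absurd h ha, fun h => absurd h ha'⟩

/-- the `ZMod 3` endgame of the private-coin lemma. -/
theorem privateCoin_endgame : ∀ δ v r₁ : ZMod 3, δ ≠ 0 → v ≠ 0 →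
    (((0 : ZMod 3) = r₁) ↔ (δ + 0 = r₁)) → ((v + 0 = r₁) ↔ (δ + v = r₁)) → False := by
  decide

/-- **P-38aq PROVED: the private-coin lemma.** -/
theorem privateCoinLemma : PrivateCoinLemma := by
  intro N hN β c x h₁ i₀ i₁ i₂ hodd hact h01 h02 h12 hi0 hi1 hi2 hd0 hfr1 hd2 hpriv hfree hperf
  obtain ⟨t₀, ht₀⟩ := exists_coinEmb_eq x (i := i₀) (mem_filter.2 ⟨mem_univ _, hi0⟩)
  obtain ⟨t₁, ht₁⟩ := exists_coinEmb_eq x (i := i₁) (mem_filter.2 ⟨mem_univ _, hi1⟩)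
  obtain ⟨t₂, ht₂⟩ := exists_coinEmb_eq x (i := i₂) (mem_filter.2 ⟨mem_univ _, hi2⟩)
  have ht01 : t₀ ≠ t₁ := fun h => h01 (by rw [← ht₀, ← ht₁, h])
  have ht02 : t₀ ≠ t₂ := fun h => h02 (by rw [← ht₀, ← ht₂, h])
  have ht21 : t₂ ≠ t₁ := fun h => h12 (by rw [← ht₁, ← ht₂, h])
  -- perfectness in test coordinates
  have hrel : ∀ y : Fin (coinsOf x).card → Bool, AffBells33.onesCard y % 2 = 0 →
      testCount (testMat β x) (testRhs β c x) (tauOf x) y % 2 = 0 := by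
    intro y hy
    exact (rel_xOf_iff hN hodd hy).1 (hperf _ (isOdd_xOf hodd hy) (kline_xOf hN hodd hy))
  set P := testMat β x with hP
  set r := testRhs β c x with hr
  -- the coefficients at the three coins
  have hP0 : ∀ b, b ≠ h₁ → P b t₀ = 0 := by
    intro b hb
    rw [hP]; unfold testMat
    by_cases hb' : kline x b = true
    · simp only [hb', ↓reduceIte, ht₀]
      unfold sdelta
      have h0 := hpriv b hb' hb
      split_ifs <;> simp [h0]
    · simp [hb']
  have hP1 : ∀ b, P b t₁ = 0 := by
    intro b
    rw [hP]; unfold testMat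
    by_cases hb' : kline x b = true
    · simp only [hb', ↓reduceIte, ht₁]
      unfold sdelta
      have h0 := hfree b hb'
      split_ifs <;> simp [h0]
    · simp [hb']
  have hδ : P h₁ t₀ ≠ 0 := by
    rw [hP]; unfold testMat
    simp only [hact, ↓reduceIte, ht₀]
    unfold sdelta
    split_ifs <;> simp [hd0]
  have hv : P h₁ t₂ ≠ 0 := by
    rw [hP]; unfold testMat
    simp only [hact, ↓reduceIte, ht₂]
    unfold sdelta
    split_ifs <;> simp [hd2]
  -- the passing sets of the four fibre points
  set S : (Fin (coinsOf x).card → Bool) → Finset (Fin N) :=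
    fun y => univ.filter fun b => (∑ t, if y t then P b t else 0) = r b with hSdef
  have hcount : ∀ y, testCount P r (tauOf x) y = tauOf x + (S y).card := fun y => rfl
  have hmemS : ∀ y b, b ∈ S y ↔ (∑ t, if y t then P b t else 0) = r b := by
    intro y b; rw [hSdef]; simp
  have hpar : ∀ y y', AffBells33.onesCard y % 2 = 0 → AffBells33.onesCard y' % 2 = 0 →
      (S y).card % 2 = (S y').card % 2 := by
    intro y y' hy hy'
    have h1 := hrel y hy
    have h2 := hrel y' hy'
    rw [hcount] at h1 h2
    omega
  -- first pair: `∅` versus `{t₀, t₁}`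
  have hA : ((0 : ZMod 3) = r h₁) ↔ (P h₁ t₀ + P h₁ t₁ = r h₁) := by
    have hm := mem_iff_of_card_mod_two (S fun _ => false) (S (pairY t₀ t₁)) h₁ (fun b hb => by
      rw [hmemS, hmemS, sum_pairY ht01, hP0 b hb, hP1 b]
      simp) (hpar _ _ onesCard_zeroY (onesCard_pairY ht01))
    rw [hmemS, hmemS, sum_pairY ht01] at hm
    simpa using hm
  -- second pair: `{t₂, t₁}` versus `{t₀, t₂}`
  have hB : (P h₁ t₂ + P h₁ t₁ = r h₁) ↔ (P h₁ t₀ + P h₁ t₂ = r h₁) := by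
    have hm := mem_iff_of_card_mod_two (S (pairY t₂ t₁)) (S (pairY t₀ t₂)) h₁ (fun b hb => by
      rw [hmemS, hmemS, sum_pairY ht21, sum_pairY ht02, hP0 b hb, hP1 b]
      simp) (hpar _ _ (onesCard_pairY ht21) (onesCard_pairY ht02))
    rw [hmemS, hmemS, sum_pairY ht21, sum_pairY ht02] at hm
    exact hm
  rw [hP1 h₁] at hA hB
  exact privateCoin_endgame (P h₁ t₀) (P h₁ t₂) (r h₁) hδ hv hA hB

end PrivateCoin


section WindowFlip

open AffBells33 AffBells28 AffBells28lit

variable {Z K : ℕ}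

/-- the test sum of row `b` at the cube point `y`. -/
def tsum (P : Fin K → Fin Z → ZMod 3) (y : Fin Z → Bool) (b : Fin K) : ZMod 3 := ∑ t, if y t then P b t else 0

/-- the window flip: set coin `t₀` (assumed off) and toggle the free coin `t₁`. -/
def wflip (t₀ t₁ : Fin Z) (y : Fin Z → Bool) : Fin Z → Bool :=
  fun t => if t = t₀ then true else if t = t₁ then !y t₁ else y t

/-- `onesCard_wflip` (planner qa-qnc0-p1 g35, exp35/WREL35.lean; see the section header above). -/
theorem onesCard_wflip {t₀ t₁ : Fin Z} (h01 : t₀ ≠ t₁) (y : Fin Z → Bool) (hy0 : y t₀ = false) :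
    AffBells33.onesCard (wflip t₀ t₁ y) % 2 = AffBells33.onesCard y % 2 := by
  unfold AffBells33.onesCard
  -- split both filters along `t = t₀`, `t = t₁`, rest
  have hrest : ∀ t, t ≠ t₀ → t ≠ t₁ → (wflip t₀ t₁ y t = true ↔ y t = true) := by
    intro t h0 h1; unfold wflip; simp [h0, h1]
  have hw0 : wflip t₀ t₁ y t₀ = true := by unfold wflip; simp
  have hw1 : wflip t₀ t₁ y t₁ = !y t₁ := by unfold wflip; simp [h01.symm]
  -- write each filter as ({t₀,t₁}-part) ∪ (rest-part)
  have hsplit : ∀ w : Fin Z → Bool, (univ.filter fun i => w i = true).card =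
      ((univ.filter fun i => w i = true).filter fun i => i = t₀ ∨ i = t₁).card +
      ((univ.filter fun i => w i = true).filter fun i => ¬ (i = t₀ ∨ i = t₁)).card := by
    intro w; rw [card_filter_add_card_filter_not]
  rw [hsplit (wflip t₀ t₁ y), hsplit y]
  have hR : ((univ.filter fun i => wflip t₀ t₁ y i = true).filter fun i => ¬ (i = t₀ ∨ i = t₁)) =
      ((univ.filter fun i => y i = true).filter fun i => ¬ (i = t₀ ∨ i = t₁)) := by
    ext i
    simp only [mem_filter, mem_univ, true_and, not_or]
    constructor
    · rintro ⟨hw, h0, h1⟩; exact ⟨(hrest i h0 h1).1 hw, h0, h1⟩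
    · rintro ⟨hw, h0, h1⟩; exact ⟨(hrest i h0 h1).2 hw, h0, h1⟩
  rw [hR]
  -- the `{t₀,t₁}` parts: for `wflip` it is `{t₀} ∪ (t₁ if ¬ y t₁)`, for `y` it is `(t₁ if y t₁)`
  have hA : ((univ.filter fun i => wflip t₀ t₁ y i = true).filter fun i => i = t₀ ∨ i = t₁) =
      (if y t₁ = true then ({t₀} : Finset (Fin Z)) else {t₀, t₁}) := by
    ext i
    simp only [mem_filter, mem_univ, true_and]
    by_cases hi0 : i = t₀
    · subst hi0; simp [hw0, h01]
      split_ifs <;> simp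
    · by_cases hi1 : i = t₁
      · subst hi1; rw [hw1]; cases hy : y i <;> simp [hi0]
      · simp only [hi0, hi1, or_self, and_false, false_iff]
        split_ifs <;> simp [hi0, hi1]
  have hB : ((univ.filter fun i => y i = true).filter fun i => i = t₀ ∨ i = t₁) =
      (if y t₁ = true then ({t₁} : Finset (Fin Z)) else ∅) := by
    ext i
    simp only [mem_filter, mem_univ, true_and]
    by_cases hi0 : i = t₀
    · subst hi0; simp [hy0]
      split_ifs <;> simp [h01]
    · by_cases hi1 : i = t₁
      · subst hi1; cases hy : y i <;> simp
      · simp only [hi0, hi1, or_self, and_false, false_iff]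
        split_ifs <;> simp [hi1]
  rw [hA, hB]
  cases hy : y t₁
  · simp [card_pair h01]
  · simp

/-- `tsum_wflip` (planner qa-qnc0-p1 g35, exp35/WREL35.lean; see the section header above). -/
theorem tsum_wflip (P : Fin K → Fin Z → ZMod 3) {t₀ t₁ : Fin Z} (h01 : t₀ ≠ t₁) (hfree : ∀ b, P b t₁ = 0)
    (y : Fin Z → Bool) (hy0 : y t₀ = false) (b : Fin K) :
    tsum P (wflip t₀ t₁ y) b = tsum P y b + P b t₀ := by
  unfold tsum
  have key : ∀ t, (if wflip t₀ t₁ y t then P b t else 0) =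
      (if y t then P b t else 0) + (if t = t₀ then P b t else 0)
        + (if t = t₁ then ((if (!y t₁) = true then P b t else 0) - (if y t₁ then P b t else 0)) else 0) := by
    intro t
    unfold wflip
    by_cases h0 : t = t₀
    · subst h0; simp [hy0, h01]
    · by_cases h1 : t = t₁
      · subst h1; simp [h0, hfree b]
      · simp [h0, h1]
  simp_rw [key]
  rw [sum_add_distrib, sum_add_distrib, sum_ite_eq', sum_ite_eq']
  simp [hfree b]

/-- **WINDOW-FLIP LEMMA in test coordinates.**  If the pass-count parities of `y` and of its window flip agree (perfectness gives this),
then among the rows READING coin `t₀` the number passing at `y` and the number passing after the shift by their own coefficient agree mod 2. -/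
theorem windowFlip_count (P : Fin K → Fin Z → ZMod 3) (r : Fin K → ZMod 3) (τ : ℕ) {t₀ t₁ : Fin Z} (h01 : t₀ ≠ t₁)
    (hfree : ∀ b, P b t₁ = 0) (y : Fin Z → Bool) (hy0 : y t₀ = false)
    (hpar : testCount P r τ y % 2 = testCount P r τ (wflip t₀ t₁ y) % 2) :
    (univ.filter fun b => P b t₀ ≠ 0 ∧ tsum P y b = r b).card % 2 =
      (univ.filter fun b => P b t₀ ≠ 0 ∧ tsum P y b + P b t₀ = r b).card % 2 := by
  unfold testCount at hpar
  have hT : ∀ w : Fin Z → Bool, (univ.filter fun b => (∑ i, if w i then P b i else 0) = r b) =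
      univ.filter fun b => tsum P w b = r b := fun w => rfl
  rw [hT, hT] at hpar
  have hsplit : ∀ w : Fin Z → Bool, (univ.filter fun b => tsum P w b = r b).card =
      (univ.filter fun b => P b t₀ ≠ 0 ∧ tsum P w b = r b).card +
      (univ.filter fun b => P b t₀ = 0 ∧ tsum P w b = r b).card := by
    intro w
    rw [← card_filter_add_card_filter_not (p := fun b => P b t₀ ≠ 0), filter_filter, filter_filter]
    congr 1
    · congr 1; ext b; simp [and_comm]
    · congr 1; ext b; simp [and_comm]
  rw [hsplit, hsplit] at hpar
  have hsame : (univ.filter fun b => P b t₀ = 0 ∧ tsum P (wflip t₀ t₁ y) b = r b) =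
      univ.filter fun b => P b t₀ = 0 ∧ tsum P y b = r b := by
    ext b
    simp only [mem_filter, mem_univ, true_and]
    constructor
    · rintro ⟨h0, h⟩; rw [tsum_wflip P h01 hfree y hy0, h0, add_zero] at h; exact ⟨h0, h⟩
    · rintro ⟨h0, h⟩; refine ⟨h0, ?_⟩; rw [tsum_wflip P h01 hfree y hy0, h0, add_zero]; exact h
  have hshift : (univ.filter fun b => P b t₀ ≠ 0 ∧ tsum P (wflip t₀ t₁ y) b = r b) =
      univ.filter fun b => P b t₀ ≠ 0 ∧ tsum P y b + P b t₀ = r b := by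
    ext b
    simp only [mem_filter, mem_univ, true_and, tsum_wflip P h01 hfree y hy0]
  rw [hsame, hshift] at hpar
  omega

/-- The fibre form: on a PERFECT fibre every window flip is parity-neutral on the rows reading the window coin. -/
theorem windowFlip_perfect (hN : 3 ≤ N) (β : Fin N → Fin N → ZMod 3) (c : Fin N → ZMod 3) (x : Fin N → Bool)
    (hodd : IsOdd x) (hperf : PerfectFibre β c (kline x)) {t₀ t₁ : Fin (coinsOf x).card} (h01 : t₀ ≠ t₁)
    (hfree : ∀ b, testMat β x b t₁ = 0) (y : Fin (coinsOf x).card → Bool) (hy : AffBells33.onesCard y % 2 = 0)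
    (hy0 : y t₀ = false) :
    (univ.filter fun b => testMat β x b t₀ ≠ 0 ∧ tsum (testMat β x) y b = testRhs β c x b).card % 2 =
      (univ.filter fun b => testMat β x b t₀ ≠ 0 ∧
        tsum (testMat β x) y b + testMat β x b t₀ = testRhs β c x b).card % 2 := by
  have hy' : AffBells33.onesCard (wflip t₀ t₁ y) % 2 = 0 := by rw [onesCard_wflip h01 y hy0]; exact hy
  have h1 := (rel_xOf_iff hN hodd hy).1 (hperf _ (isOdd_xOf hodd hy) (kline_xOf hN hodd hy))
  have h2 := (rel_xOf_iff hN hodd hy').1 (hperf _ (isOdd_xOf hodd hy') (kline_xOf hN hodd hy'))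
  exact windowFlip_count _ _ _ h01 hfree y hy0 (by rw [h1, h2])

end WindowFlip

end Summit.QuantumAdvantage.AdviceFreeQNC0.AffBells35
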